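import Mathlib
import HarnessLib
import Summits.HubbardSuperconductivity.HubbardSuperconductivity.Theorems.KLProgrammeC4aBareVertexStrings
import Summits.HubbardSuperconductivity.HubbardSuperconductivity.Theorems.KLProgrammeKLRegimeEngineCovarianceResponseAtPoint

/-!
# K3 ENGINE-FLOW child (stmt-HubbardSuperconductivity-20437 `KLRegimeEngineV17F2`), located «(X).2′-BASE-ROOM», cure (β) «SCALE0-MEMBER-DIFF», part F2:
# SIZE AND SPARSITY OF THE BARE HUBBARD VERTEX KERNEL and the entry sums of a normal line — the momentum-space sizes behind the second-order member bound

Cell `gate-hubbard-kl`, seat hubbard-kl-k3c5-p1 (g22).  Part F1 (`…EngineScaleZeroSmearingSecondOrder`) wrote the member difference of the smeared scale-`0`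
quartic kernel as `−½·[4·(one-hard-line trees over the d-tadpole) − 2·4!·(d ⊗ C bubbles)] + (T₃ tail)` — finite label sums of products
`contr d · contr C · kernel V_U 4 · kernel V_U 4` resp. `contr C · kernel (Δ_d W) 2 · kernel V_U 4`.  This file supplies the three elementary sizes that bound
them WITHOUT any position-space constant:

* §1 conservation pins a leg: `eq_of_conserving_left/right` (integer labels injective, cf. `KLRegimeSplit.matsubaraIdx_eq_of_matsubaraInt_eq`) (given the other three frequency–momenta, at most one label conserves), and the counting
  `sum_ite_const_le_of_subsingleton`;
* §2 the bare quartic kernel `F₄[V_U]`: **`norm_kernel_hubbardInteraction_four_le`** — `‖kernel V_U 4 X‖ ≤ |U|/|βL²|³/24` at EVERY string (c4a-1's six charge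
  patterns + the three-equal-charges vanishing), and **`sum_norm_kernel_hubbardInteraction_slot_le`** — for three legs fixed, the sum over the fourth leg's label is
  `≤ 4·|U|/|βL²|³/24` (one momentum by conservation, `≤ 2 × 2` spin/charge values; slot `1`, and slot `0` by antisymmetry);
* §3 a normal line `contr (normalCovariance s)`: `‖contr … X Y‖ ≤ ‖s X.1‖`, row sum `Σ_Y ‖contr … X Y‖ ≤ ‖s X.1‖`, entry sum `Σ_{X,Y} ‖contr … X Y‖ ≤ 2·Σ_p ‖s p‖`.

Pure bookkeeping on landed Feynman rules; no definitions; nothing about the model's regime, no stub of 20437, K3, U₀ or superconductivity is asserted.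
References: BGM 2006 §2.1 (2.6a) [cite: BenfattoGiulianiMastropietro2006]; Salmhofer 1999 §2.4, §4.3 (4.95) [cite: Salmhofer1999].
-/

noncomputable section

namespace Summit.HubbardSuperconductivity.HubbardSuperconductivity.Theorems.EngineV8

set_option linter.dupNamespace false -- summit = problem name (single-conjunct summit), D-0017

open Literature.MathematicalPhysics.QuantumLattice Literature.Probability.LatticeModels GrassmannAlgebra Finset Matrix
open Summit.HubbardSuperconductivity.HubbardSuperconductivity.Theorems.C4a

variable {L M : ℕ}

/-! ## §1 Conservation pins a leg -/

/-- **Conservation pins a leg (left slot)**: `n_p + n_x = N`, `p⃗ + x⃗ = K⃗` has at most one solution `p`. [cite: BenfattoGiulianiMastropietro2006, §2.1 (2.6a)] -/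
theorem eq_of_conserving_left {p p' x : FreqMomentum L M} {N : ℤ} {K : TorusSite 2 L}
    (h : matsubaraInt M p.1 + matsubaraInt M x.1 = N ∧ p.2 + x.2 = K) (h' : matsubaraInt M p'.1 + matsubaraInt M x.1 = N ∧ p'.2 + x.2 = K) : p = p' := by
  refine Prod.ext (Fin.ext (by unfold matsubaraInt at h h'; omega)) ?_
  have := h.2.trans h'.2.symm
  exact add_right_cancel this

/-- **Conservation pins a leg (right slot)**: `n_x + n_p = N`, `x⃗ + p⃗ = K⃗` has at most one solution `p`. [cite: BenfattoGiulianiMastropietro2006, §2.1 (2.6a)] -/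
theorem eq_of_conserving_right {p p' x : FreqMomentum L M} {N : ℤ} {K : TorusSite 2 L}
    (h : matsubaraInt M x.1 + matsubaraInt M p.1 = N ∧ x.2 + p.2 = K) (h' : matsubaraInt M x.1 + matsubaraInt M p'.1 = N ∧ x.2 + p'.2 = K) : p = p' := by
  refine Prod.ext (Fin.ext (by unfold matsubaraInt at h h'; omega)) ?_
  have := h.2.trans h'.2.symm
  exact add_left_cancel this

/-- **Counting**: a nonnegative constant summed over a subsingleton predicate is at most the constant. -/
theorem sum_ite_const_le_of_subsingleton {ι : Type*} [Fintype ι] (P : ι → Prop) [DecidablePred P] (hP : ∀ i j, P i → P j → i = j)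
    {t : ℝ} (ht : 0 ≤ t) : (∑ i, if P i then t else 0) ≤ t := by
  rw [Finset.sum_ite, Finset.sum_const_zero, add_zero, Finset.sum_const, nsmul_eq_mul]
  have hcard : ((Finset.univ.filter P).card : ℝ) ≤ 1 := by
    exact_mod_cast Finset.card_le_one.2 fun i hi j hj => hP i j (Finset.mem_filter.1 hi).2 (Finset.mem_filter.1 hj).2
  nlinarith

/-! ## §2 The bare quartic kernel: size at every string, sparsity in one leg -/

section Vertex

variable [NeZero L] (β U : ℝ)

/-- The norm of the `(−,−,+,+)` master value: `‖kernel V_U 4 (a s₁ −, b s₂ −, c s₃ +, d s₄ +)‖ ≤ [n_a + n_b = n_c + n_d ∧ a⃗ + b⃗ = c⃗ + d⃗]·|U|/|βL²|³/24`.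
[cite: BenfattoGiulianiMastropietro2006, §2.1 (2.6a)] -/
theorem norm_kernel_hubbardInteraction_mmpp_le (a b c d : FreqMomentum L M) (s₁ s₂ s₃ s₄ : Fin 2) :
    ‖kernel ℂ (hubbardInteraction L M β U) 4 ![((a, s₁), 1), ((b, s₂), 1), ((c, s₃), 0), ((d, s₄), 0)]‖ ≤
      if matsubaraInt M a.1 + matsubaraInt M b.1 = matsubaraInt M c.1 + matsubaraInt M d.1 ∧ a.2 + b.2 = c.2 + d.2 then
        |U| / |β * (L : ℝ) ^ 2| ^ 3 / 24 else 0 := by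
  rw [kernel_hubbardInteraction_mmpp]
  have hval : ‖((((U / (β * (L : ℝ) ^ 2) ^ 3 : ℝ)) : ℂ) * (((4 : ℕ).factorial : ℚ)⁻¹ • (1 : ℂ)))‖ = |U| / |β * (L : ℝ) ^ 2| ^ 3 / 24 := by
    rw [Rat.smul_one_eq_cast, norm_mul, Complex.norm_real, Real.norm_eq_abs, abs_div, abs_pow]
    norm_num [Nat.factorial]
    ring
  have hpos : 0 ≤ |U| / |β * (L : ℝ) ^ 2| ^ 3 / 24 := by positivity
  split_ifs <;> simp_all [norm_neg]

/-- **`‖kernel V_U 4 X‖ ≤ |U|/|βL²|³/24` at EVERY leg string** (the six two-plus-two charge patterns reduce to the master value, every other pattern has three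
equal charges and vanishes). [cite: BenfattoGiulianiMastropietro2006, §2.1 (2.6a)] -/
theorem norm_kernel_hubbardInteraction_four_le (X : Fin 4 → HubbardFieldIdx L M) :
    ‖kernel ℂ (hubbardInteraction L M β U) 4 X‖ ≤ |U| / |β * (L : ℝ) ^ 2| ^ 3 / 24 := by
  have hpos : 0 ≤ |U| / |β * (L : ℝ) ^ 2| ^ 3 / 24 := by positivity
  have hm : ∀ (a b c d : FreqMomentum L M) (s₁ s₂ s₃ s₄ : Fin 2),
      ‖kernel ℂ (hubbardInteraction L M β U) 4 ![((a, s₁), 1), ((b, s₂), 1), ((c, s₃), 0), ((d, s₄), 0)]‖ ≤ |U| / |β * (L : ℝ) ^ 2| ^ 3 / 24 :=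
    fun a b c d s₁ s₂ s₃ s₄ => (norm_kernel_hubbardInteraction_mmpp_le β U a b c d s₁ s₂ s₃ s₄).trans (by split_ifs; exacts [le_rfl, hpos])
  have hX : X = ![(((X 0).1.1, (X 0).1.2), (X 0).2), (((X 1).1.1, (X 1).1.2), (X 1).2), (((X 2).1.1, (X 2).1.2), (X 2).2),
      (((X 3).1.1, (X 3).1.2), (X 3).2)] := by
    funext i; fin_cases i <;> simp
  have two : ∀ x : Fin 2, x = 0 ∨ x = 1 := by decide
  -- three equal charges
  have h3 : ∀ {i j k : Fin 4}, i ≠ j → i ≠ k → j ≠ k → (X i).2 = (X j).2 → (X i).2 = (X k).2 →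
      ‖kernel ℂ (hubbardInteraction L M β U) 4 X‖ ≤ |U| / |β * (L : ℝ) ^ 2| ^ 3 / 24 := by
    intro i j k hij hik hjk h1 h2
    rw [kernel_hubbardInteraction_eq_zero_of_three_charges β U X hij hik hjk h1 h2, norm_zero]
    exact hpos
  rcases two (X 0).2 with h0 | h0 <;> rcases two (X 1).2 with h1 | h1 <;> rcases two (X 2).2 with h2 | h2 <;> rcases two (X 3).2 with h3' | h3'
  -- 0000
  · exact h3 (i := 0) (j := 1) (k := 2) (by decide) (by decide) (by decide) (h0.trans h1.symm) (h0.trans h2.symm)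
  -- 0001
  · exact h3 (i := 0) (j := 1) (k := 2) (by decide) (by decide) (by decide) (h0.trans h1.symm) (h0.trans h2.symm)
  -- 0010
  · exact h3 (i := 0) (j := 1) (k := 3) (by decide) (by decide) (by decide) (h0.trans h1.symm) (h0.trans h3'.symm)
  -- 0011 : ppmm
  · rw [hX, h0, h1, h2, h3', kernel_hubbardInteraction_ppmm]; exact hm _ _ _ _ _ _ _ _
  -- 0100
  · exact h3 (i := 0) (j := 2) (k := 3) (by decide) (by decide) (by decide) (h0.trans h2.symm) (h0.trans h3'.symm)
  -- 0101 : pmpm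
  · rw [hX, h0, h1, h2, h3', kernel_hubbardInteraction_pmpm, norm_neg]; exact hm _ _ _ _ _ _ _ _
  -- 0110 : pmmp
  · rw [hX, h0, h1, h2, h3', kernel_hubbardInteraction_pmmp]; exact hm _ _ _ _ _ _ _ _
  -- 0111
  · exact h3 (i := 1) (j := 2) (k := 3) (by decide) (by decide) (by decide) (h1.trans h2.symm) (h1.trans h3'.symm)
  -- 1000
  · exact h3 (i := 1) (j := 2) (k := 3) (by decide) (by decide) (by decide) (h1.trans h2.symm) (h1.trans h3'.symm)
  -- 1001 : mppm
  · rw [hX, h0, h1, h2, h3', kernel_hubbardInteraction_mppm]; exact hm _ _ _ _ _ _ _ _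
  -- 1010 : mpmp
  · rw [hX, h0, h1, h2, h3', kernel_hubbardInteraction_mpmp, norm_neg]; exact hm _ _ _ _ _ _ _ _
  -- 1011
  · exact h3 (i := 0) (j := 2) (k := 3) (by decide) (by decide) (by decide) (h0.trans h2.symm) (h0.trans h3'.symm)
  -- 1100 : mmpp
  · rw [hX, h0, h1, h2, h3']; exact hm _ _ _ _ _ _ _ _
  -- 1101
  · exact h3 (i := 0) (j := 1) (k := 3) (by decide) (by decide) (by decide) (h0.trans h1.symm) (h0.trans h3'.symm)
  -- 1110
  · exact h3 (i := 0) (j := 1) (k := 2) (by decide) (by decide) (by decide) (h0.trans h1.symm) (h0.trans h2.symm)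
  -- 1111
  · exact h3 (i := 0) (j := 1) (k := 2) (by decide) (by decide) (by decide) (h0.trans h1.symm) (h0.trans h2.symm)

omit [NeZero L] in
/-- Summing a pointwise `[P]·t` majorant over a subsingleton predicate. -/
theorem sum_norm_le_of_ite {ι : Type*} [Fintype ι] {f : ι → ℂ} (P : ι → Prop) [DecidablePred P] (hP : ∀ i j, P i → P j → i = j)
    {t : ℝ} (ht : 0 ≤ t) (h : ∀ i, ‖f i‖ ≤ if P i then t else 0) : ∑ i, ‖f i‖ ≤ t :=
  (Finset.sum_le_sum fun i _ => h i).trans (sum_ite_const_le_of_subsingleton P hP ht)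

/-- **Sparsity of the bare vertex in ONE leg, the other three fixed (slot `1`)**: for every spin `s` and charge `c` of the free leg,
`Σ_p ‖kernel V_U 4 (Y₀, (p,s,c), Y₂, Y₃)‖ ≤ |U|/|βL²|³/24` — conservation pins the free frequency–momentum. [cite: BenfattoGiulianiMastropietro2006, §2.1 (2.6a)] -/
theorem sum_norm_kernel_hubbardInteraction_slot_one_spin_charge_le (Y₀ Y₂ Y₃ : HubbardFieldIdx L M) (s c : Fin 2) :
    ∑ p : FreqMomentum L M, ‖kernel ℂ (hubbardInteraction L M β U) 4 ![Y₀, ((p, s), c), Y₂, Y₃]‖ ≤ |U| / |β * (L : ℝ) ^ 2| ^ 3 / 24 := by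
  have hpos : 0 ≤ |U| / |β * (L : ℝ) ^ 2| ^ 3 / 24 := by positivity
  obtain ⟨⟨a, s₀⟩, c₀⟩ := Y₀
  obtain ⟨⟨b, s₂⟩, c₂⟩ := Y₂
  obtain ⟨⟨e, s₃⟩, c₃⟩ := Y₃
  have two : ∀ x : Fin 2, x = 0 ∨ x = 1 := by decide
  -- three equal charges: every term vanishes
  have h3 : ∀ {i j k : Fin 4}, i ≠ j → i ≠ k → j ≠ k →
      (∀ p : FreqMomentum L M, ((![((a, s₀), c₀), ((p, s), c), ((b, s₂), c₂), ((e, s₃), c₃)] : Fin 4 → HubbardFieldIdx L M) i).2 =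
        ((![((a, s₀), c₀), ((p, s), c), ((b, s₂), c₂), ((e, s₃), c₃)] : Fin 4 → HubbardFieldIdx L M) j).2) →
      (∀ p : FreqMomentum L M, ((![((a, s₀), c₀), ((p, s), c), ((b, s₂), c₂), ((e, s₃), c₃)] : Fin 4 → HubbardFieldIdx L M) i).2 =
        ((![((a, s₀), c₀), ((p, s), c), ((b, s₂), c₂), ((e, s₃), c₃)] : Fin 4 → HubbardFieldIdx L M) k).2) →
      ∑ p : FreqMomentum L M, ‖kernel ℂ (hubbardInteraction L M β U) 4 ![((a, s₀), c₀), ((p, s), c), ((b, s₂), c₂), ((e, s₃), c₃)]‖ ≤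
        |U| / |β * (L : ℝ) ^ 2| ^ 3 / 24 := by
    intro i j k hij hik hjk h1 h2
    rw [Finset.sum_eq_zero fun p _ => by
      rw [kernel_hubbardInteraction_eq_zero_of_three_charges β U _ hij hik hjk (h1 p) (h2 p), norm_zero]]
    exact hpos
  rcases two c₀ with rfl | rfl <;> rcases two c with rfl | rfl <;> rcases two c₂ with rfl | rfl <;> rcases two c₃ with rfl | rfl
  -- 0000
  · exact h3 (i := 0) (j := 1) (k := 2) (by decide) (by decide) (by decide) (fun _ => rfl) (fun _ => rfl)
  -- 0001
  · exact h3 (i := 0) (j := 1) (k := 2) (by decide) (by decide) (by decide) (fun _ => rfl) (fun _ => rfl)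
  -- 0010
  · exact h3 (i := 0) (j := 1) (k := 3) (by decide) (by decide) (by decide) (fun _ => rfl) (fun _ => rfl)
  -- 0011 : ppmm → mmpp(b, e, a, p)
  · refine sum_norm_le_of_ite
      (fun p : FreqMomentum L M => matsubaraInt M b.1 + matsubaraInt M e.1 = matsubaraInt M a.1 + matsubaraInt M p.1 ∧ b.2 + e.2 = a.2 + p.2)
      (fun p p' hp hp' => eq_of_conserving_right ⟨hp.1.symm, hp.2.symm⟩ ⟨hp'.1.symm, hp'.2.symm⟩) hpos fun p => ?_
    rw [kernel_hubbardInteraction_ppmm]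
    exact norm_kernel_hubbardInteraction_mmpp_le β U _ _ _ _ _ _ _ _
  -- 0100
  · exact h3 (i := 0) (j := 2) (k := 3) (by decide) (by decide) (by decide) (fun _ => rfl) (fun _ => rfl)
  -- 0101 : pmpm → −mmpp(p, e, a, b)
  · refine sum_norm_le_of_ite
      (fun p : FreqMomentum L M => matsubaraInt M p.1 + matsubaraInt M e.1 = matsubaraInt M a.1 + matsubaraInt M b.1 ∧ p.2 + e.2 = a.2 + b.2)
      (fun p p' hp hp' => eq_of_conserving_left hp hp') hpos fun p => ?_
    rw [kernel_hubbardInteraction_pmpm, norm_neg]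
    exact norm_kernel_hubbardInteraction_mmpp_le β U _ _ _ _ _ _ _ _
  -- 0110 : pmmp → mmpp(p, b, a, e)
  · refine sum_norm_le_of_ite
      (fun p : FreqMomentum L M => matsubaraInt M p.1 + matsubaraInt M b.1 = matsubaraInt M a.1 + matsubaraInt M e.1 ∧ p.2 + b.2 = a.2 + e.2)
      (fun p p' hp hp' => eq_of_conserving_left hp hp') hpos fun p => ?_
    rw [kernel_hubbardInteraction_pmmp]
    exact norm_kernel_hubbardInteraction_mmpp_le β U _ _ _ _ _ _ _ _
  -- 0111
  · exact h3 (i := 1) (j := 2) (k := 3) (by decide) (by decide) (by decide) (fun _ => rfl) (fun _ => rfl)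
  -- 1000
  · exact h3 (i := 1) (j := 2) (k := 3) (by decide) (by decide) (by decide) (fun _ => rfl) (fun _ => rfl)
  -- 1001 : mppm → mmpp(a, e, p, b)
  · refine sum_norm_le_of_ite
      (fun p : FreqMomentum L M => matsubaraInt M a.1 + matsubaraInt M e.1 = matsubaraInt M p.1 + matsubaraInt M b.1 ∧ a.2 + e.2 = p.2 + b.2)
      (fun p p' hp hp' => eq_of_conserving_left ⟨hp.1.symm, hp.2.symm⟩ ⟨hp'.1.symm, hp'.2.symm⟩) hpos fun p => ?_
    rw [kernel_hubbardInteraction_mppm]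
    exact norm_kernel_hubbardInteraction_mmpp_le β U _ _ _ _ _ _ _ _
  -- 1010 : mpmp → −mmpp(a, b, p, e)
  · refine sum_norm_le_of_ite
      (fun p : FreqMomentum L M => matsubaraInt M a.1 + matsubaraInt M b.1 = matsubaraInt M p.1 + matsubaraInt M e.1 ∧ a.2 + b.2 = p.2 + e.2)
      (fun p p' hp hp' => eq_of_conserving_left ⟨hp.1.symm, hp.2.symm⟩ ⟨hp'.1.symm, hp'.2.symm⟩) hpos fun p => ?_
    rw [kernel_hubbardInteraction_mpmp, norm_neg]
    exact norm_kernel_hubbardInteraction_mmpp_le β U _ _ _ _ _ _ _ _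
  -- 1011
  · exact h3 (i := 0) (j := 2) (k := 3) (by decide) (by decide) (by decide) (fun _ => rfl) (fun _ => rfl)
  -- 1100 : mmpp(a, p, b, e)
  · refine sum_norm_le_of_ite
      (fun p : FreqMomentum L M => matsubaraInt M a.1 + matsubaraInt M p.1 = matsubaraInt M b.1 + matsubaraInt M e.1 ∧ a.2 + p.2 = b.2 + e.2)
      (fun p p' hp hp' => eq_of_conserving_right hp hp') hpos fun p => ?_
    exact norm_kernel_hubbardInteraction_mmpp_le β U _ _ _ _ _ _ _ _
  -- 1101
  · exact h3 (i := 0) (j := 1) (k := 3) (by decide) (by decide) (by decide) (fun _ => rfl) (fun _ => rfl)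
  -- 1110
  · exact h3 (i := 0) (j := 1) (k := 2) (by decide) (by decide) (by decide) (fun _ => rfl) (fun _ => rfl)
  -- 1111
  · exact h3 (i := 0) (j := 1) (k := 2) (by decide) (by decide) (by decide) (fun _ => rfl) (fun _ => rfl)

/-- **Sparsity, slot `1`, all spins and charges of the free leg**: `Σ_{X′} ‖kernel V_U 4 (Y₀, X′, Y₂, Y₃)‖ ≤ 4·|U|/|βL²|³/24`.
[cite: BenfattoGiulianiMastropietro2006, §2.1 (2.6a)] -/
theorem sum_norm_kernel_hubbardInteraction_slot_one_le (Y₀ Y₂ Y₃ : HubbardFieldIdx L M) :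
    ∑ X' : HubbardFieldIdx L M, ‖kernel ℂ (hubbardInteraction L M β U) 4 ![Y₀, X', Y₂, Y₃]‖ ≤ 4 * (|U| / |β * (L : ℝ) ^ 2| ^ 3 / 24) := by
  rw [Fintype.sum_prod_type, Fintype.sum_prod_type]
  have h := fun s c => sum_norm_kernel_hubbardInteraction_slot_one_spin_charge_le β U Y₀ Y₂ Y₃ s c
  calc ∑ p : FreqMomentum L M, ∑ s : Fin 2, ∑ c : Fin 2, ‖kernel ℂ (hubbardInteraction L M β U) 4 ![Y₀, ((p, s), c), Y₂, Y₃]‖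
      = ∑ s : Fin 2, ∑ c : Fin 2, ∑ p : FreqMomentum L M, ‖kernel ℂ (hubbardInteraction L M β U) 4 ![Y₀, ((p, s), c), Y₂, Y₃]‖ := by
        rw [Finset.sum_comm]
        exact Finset.sum_congr rfl fun s _ => Finset.sum_comm
    _ ≤ ∑ _s : Fin 2, ∑ _c : Fin 2, |U| / |β * (L : ℝ) ^ 2| ^ 3 / 24 :=
        Finset.sum_le_sum fun s _ => Finset.sum_le_sum fun c _ => h s c
    _ = 4 * (|U| / |β * (L : ℝ) ^ 2| ^ 3 / 24) := by simp; ring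

/-- **Sparsity, slot `0`**: `Σ_{X} ‖kernel V_U 4 (X, Y₁, Y₂, Y₃)‖ ≤ 4·|U|/|βL²|³/24` (antisymmetry `(0 1)`). [cite: BenfattoGiulianiMastropietro2006, §2.1 (2.6a)] -/
theorem sum_norm_kernel_hubbardInteraction_slot_zero_le (Y₁ Y₂ Y₃ : HubbardFieldIdx L M) :
    ∑ X : HubbardFieldIdx L M, ‖kernel ℂ (hubbardInteraction L M β U) 4 ![X, Y₁, Y₂, Y₃]‖ ≤ 4 * (|U| / |β * (L : ℝ) ^ 2| ^ 3 / 24) := by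
  refine le_of_eq_of_le (Finset.sum_congr rfl fun X _ => ?_) (sum_norm_kernel_hubbardInteraction_slot_one_le β U Y₁ Y₂ Y₃)
  have h : (![X, Y₁, Y₂, Y₃] : Fin 4 → HubbardFieldIdx L M) = (![Y₁, X, Y₂, Y₃] : Fin 4 → HubbardFieldIdx L M) ∘ Equiv.swap (0 : Fin 4) 1 := by
    funext i; fin_cases i <;> simp [Equiv.swap_apply_def]
  rw [h, Literature.MathematicalPhysics.QuantumLattice.kernel_comp_perm, Equiv.Perm.sign_swap (by decide)]
  simp

end Vertex

/-! ## §3 Entry sizes of a normal line -/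

section Lines

variable [NeZero L]

omit [NeZero L] in
/-- Pointwise: `‖contr (normalCovariance s) X Y‖ ≤ ‖s X.1‖`. [cite: Salmhofer1999, §4.3 (4.95)] -/
theorem norm_contr_normalCovariance_le (s : FreqMomentum L M × Fin 2 → ℂ) (X Y : HubbardFieldIdx L M) :
    ‖contr ℂ (normalCovariance L M s) X Y‖ ≤ ‖s X.1‖ := by
  rw [contr_apply, normalCovariance_apply, normalCovariance_apply]
  have hq : ‖((1 / 2 : ℚ) • (1 : ℂ))‖ = 1 / 2 := by rw [Rat.smul_one_eq_cast]; norm_num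
  rw [norm_mul, hq]
  by_cases h : Y.1 = X.1
  · rw [if_pos h, if_pos h.symm, h]
    have hn : ∀ z w : ℂ, ‖z‖ ≤ ‖s X.1‖ → ‖w‖ ≤ ‖s X.1‖ → 1 / 2 * ‖z - w‖ ≤ ‖s X.1‖ := fun z w hz hw => by
      have := norm_sub_le z w; linarith
    refine hn _ _ ?_ ?_ <;> split_ifs <;> simp
  · rw [if_neg h, if_neg (Ne.symm h), sub_zero, norm_zero, mul_zero]
    exact norm_nonneg _

/-- Row sum: `Σ_Y ‖contr (normalCovariance s) X Y‖ ≤ ‖s X.1‖` (only `Y = X̄` pairs). [cite: Salmhofer1999, §4.3 (4.95)] -/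
theorem sum_norm_contr_normalCovariance_le (s : FreqMomentum L M × Fin 2 → ℂ) (X : HubbardFieldIdx L M) :
    ∑ Y : HubbardFieldIdx L M, ‖contr ℂ (normalCovariance L M s) X Y‖ ≤ ‖s X.1‖ := by
  rw [Finset.sum_eq_single (X.1, 1 - X.2) (fun Y _ hY => ?_) (fun h => absurd (Finset.mem_univ _) h)]
  · exact norm_contr_normalCovariance_le s X _
  · rw [contr_apply, normalCovariance_eq_zero_of_ne_bar s X Y hY, normalCovariance_eq_zero_of_ne_bar s Y X ?_, sub_zero, mul_zero, norm_zero]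
    intro hX
    apply hY
    rw [hX]
    obtain ⟨q, c⟩ := Y
    have two : ∀ x : Fin 2, x = 0 ∨ x = 1 := by decide
    rcases two c with rfl | rfl <;> simp

/-- Entry sum: `Σ_{X,Y} ‖contr (normalCovariance s) X Y‖ ≤ 2·Σ_p ‖s p‖`. [cite: Salmhofer1999, §4.3 (4.95)] -/
theorem sum_sum_norm_contr_normalCovariance_le (s : FreqMomentum L M × Fin 2 → ℂ) :
    ∑ X : HubbardFieldIdx L M, ∑ Y : HubbardFieldIdx L M, ‖contr ℂ (normalCovariance L M s) X Y‖ ≤ 2 * ∑ p, ‖s p‖ := by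
  refine (Finset.sum_le_sum fun X _ => sum_norm_contr_normalCovariance_le s X).trans (le_of_eq ?_)
  rw [Fintype.sum_prod_type, Finset.mul_sum]
  exact Finset.sum_congr rfl fun p _ => by simp [two_mul]

end Lines

end Summit.HubbardSuperconductivity.HubbardSuperconductivity.Theorems.EngineV8

end
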